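import Summits.Ventures.HodgeRepro2.T7SupportBergmanOneVectorFourier

/-!
# The one-vector chapter for a HIGHER `K`-type `u_A = zⁿ` (support, seat p1)

L3-ARGUMENT §4a (ll. 46–47): the `(T_A, μ_A)`-weight vector `u_A` of `π⁰` is the `K`-type `(5/2, −5/2)` — the
`K`-type `n = 1` of the weight-3 series `π⁰_triv` and the LOWEST `K`-type of the weight-5 series `π⁰_adj`. Rows 700–702
treat `u_A = 1`; this file redoes the one-vector chapter for `u_A = zⁿ` in the weight-`k` model, with the expansion of
`φ_{h,n} := π_k(h⁻¹) zⁿ = Σ_m c_m zᵐ` as a PARAMETER (any coefficient sequence `c` with `HasSum`; row 701's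
`coherentCoeff` is the case `n = 0`, the explicit case `n = 1` is `T7SupportBergmanOneVectorWeightOne`):

* the `a_bound`: `‖⟨π_k(γ h rot(w) h⁻¹) zⁿ, zⁿ⟩_k‖ ≤ s(h)^k C_{n,n} ⟨zⁿ,zⁿ⟩_k · κ(γ)^{−k/2}` uniformly in `w`
  (`norm_matrixCoeff_monomial_conj_torus_le_kappa`) — the same exponent `α = k/2` for every `K`-type;
* the Fourier coefficient `Φ_{−(k+2m)}(γ) = c_m ⟨π_k(γ h) zᵐ, zⁿ⟩_k` (`monomialFourierCoeff_eq`), a matrix coefficient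
  with fixed vectors; at `γ = 1`: `Φ_{−(k+2m)}(1) = |c_m|² ⟨zᵐ, zᵐ⟩_k` (`monomialFourierCoeff_one`), so
  **`hq` for `u_A = zⁿ` at the `K`-type `q = −(k+2m)` is exactly `c_m ≠ 0`** (`monomialFourierCoeff_one_ne_zero_iff`):
  the `m`-th Taylor coefficient of `π_k(h⁻¹) zⁿ` — memo v13 §2g (5)'s «`hq_v : c_{q_v} ≠ 0`» verbatim in the model.

Explicit model only; nothing about the adelic group, the global invariant, or any period.
Blind lane: Mathlib + the HodgeRepro2 prefix only; no sorry; axioms ⊆ {propext, Classical.choice, Quot.sound}.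
-/

namespace Summit.Ventures.HodgeRepro2.T7SupportBergmanOneVectorMonomial

open MeasureTheory Metric
open T5SU11Unimodular T5SU11Fibration T5BergmanCoefficient T5BergmanMatrixCoeff T5HaarCircle T5BergmanActStable
  T5BergmanKernel T5BergmanParseval T5BergmanFourier T5BergmanUnitary T5BergmanCoefficientL2 T5BergmanCoeffOrtho
  T5BergmanKTypeMatrix T7SupportTwoTorusInvariant T7SupportKappaCartan T7SupportCartanShift
  T7SupportBergmanOrbitalDecay T7SupportBergmanOneVectorDecay T7SupportBergmanOneVectorFourier

/-- **the `a_bound` for `u_A = zⁿ`, uniformly along the second-torus orbit**: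
`‖⟨π_k(γ h rot(w) h⁻¹) zⁿ, zⁿ⟩_k‖ ≤ s(h)^k C_{n,n} ⟨zⁿ,zⁿ⟩_k κ(γ)^{−k/2}` -/
theorem norm_matrixCoeff_monomial_conj_torus_le_kappa (k : ℕ) (hk : 2 ≤ k) (n : ℕ) (γ h : SU11) (w : Circle) :
    ‖matrixCoeff k (fun z => z ^ n) (fun z => z ^ n) (γ * (h * rot w * h⁻¹))‖ ≤
      shiftConst h ^ k * (decayConst k n n * monomialNormSq k n) *
        (kappa (starRingEnd ℂ) dd (colBasis h) (mat γ)).re ^ (-(k : ℝ) / 2) := by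
  have hc := norm_matrixCoeff_monomial_monomial_le k hk (γ * (h * rot w * h⁻¹)) n n
  have h1 := inv_norm_mat_conj_torus_zero_zero_le γ h w
  have h2 : ‖mat (γ * (h * rot w * h⁻¹)) 0 0‖⁻¹ ^ k ≤ (shiftConst h * ‖mat (γ * h) 0 0‖⁻¹) ^ k :=
    pow_le_pow_left₀ (inv_nonneg.2 (norm_nonneg _)) h1 k
  rw [mul_pow, inv_pow_eq_normSq_rpow (mat_zero_zero_ne_zero (γ * h)) k] at h2
  rw [kappa_eq_normSq, Complex.ofReal_re]
  have hC : 0 ≤ decayConst k n n * monomialNormSq k n :=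
    mul_nonneg (by unfold decayConst; positivity) (monomialNormSq_pos k n).le
  calc ‖matrixCoeff k (fun z => z ^ n) (fun z => z ^ n) (γ * (h * rot w * h⁻¹))‖
      ≤ decayConst k n n * monomialNormSq k n * ‖mat (γ * (h * rot w * h⁻¹)) 0 0‖⁻¹ ^ k := hc
    _ ≤ decayConst k n n * monomialNormSq k n *
          (shiftConst h ^ k * Complex.normSq (mat (γ * h) 0 0) ^ (-(k : ℝ) / 2)) := by gcongr
    _ = _ := by ring

/-- the monomial `zⁿ` as a power series: `δ_{jn}` -/
theorem hasSum_monomial (n : ℕ) (w : ℂ) :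
    HasSum (fun j => (if j = n then (1 : ℂ) else 0) * w ^ j) (w ^ n) := by
  have h := hasSum_ite_eq n (w ^ n)
  refine h.congr_fun fun j => ?_
  by_cases hj : j = n <;> simp [hj]

/-- the coefficient along the second-torus orbit is a right-rotated coefficient of `φ_{h,n} = π_k(h⁻¹) zⁿ` -/
theorem matrixCoeff_monomial_conj_torus (k n : ℕ) (γ h : SU11) (w : Circle) :
    matrixCoeff k (fun z => z ^ n) (fun z => z ^ n) (γ * (h * rot w * h⁻¹)) =
      matrixCoeff k (act k h⁻¹ fun z => z ^ n) (fun z => z ^ n) (γ * h * rot w) := by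
  have e : γ * (h * rot w * h⁻¹) = (γ * h * rot w) * h⁻¹ := by group
  rw [e, matrixCoeff_mul]

/-- the first torus: `⟨π_k(rot u · g) zⁿ, zⁿ⟩_k = u^{−(k+2n)} ⟨π_k(g) zⁿ, zⁿ⟩_k` (the `K`-type of `zⁿ`) -/
theorem matrixCoeff_monomial_rot_mul (k n : ℕ) (hk : 2 ≤ k) (u : Circle) (g : SU11) :
    matrixCoeff k (fun z => z ^ n) (fun z => z ^ n) (rot u * g) =
      ((u : ℂ)⁻¹) ^ (k + 2 * n) * matrixCoeff k (fun z => z ^ n) (fun z => z ^ n) g :=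
  T5BergmanCoeffCartan.matrixCoeff_rot_mul_monomial k n hk _ u g

variable [MeasurableSpace Circle] [BorelSpace Circle]

/-- **the `q`-th Fourier coefficient of the one-vector coefficient of `zⁿ` along the second torus** -/
noncomputable def monomialFourierCoeff (k n : ℕ) (h : SU11) (q : ℤ) (γ : SU11) : ℂ :=
  ∫ w : Circle, (starRingEnd ℂ) ((w : ℂ) ^ q) *
    matrixCoeff k (fun z => z ^ n) (fun z => z ^ n) (γ * (h * rot w * h⁻¹)) ∂haarCircle

/-- **`Φ_{−(k+2m)}(γ) = c_m ⟨π_k(γ h) zᵐ, zⁿ⟩_k`** for any expansion `π_k(h⁻¹) zⁿ = Σ c_j z^j` on the disc -/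
theorem monomialFourierCoeff_eq (k : ℕ) (hk : 2 ≤ k) (n : ℕ) (h : SU11) (c : ℕ → ℂ)
    (hc : ∀ z ∈ ball (0 : ℂ) 1, HasSum (fun j => c j * z ^ j) (act k h⁻¹ (fun z => z ^ n) z)) (m : ℕ)
    (γ : SU11) :
    monomialFourierCoeff k n h (-((k + 2 * m : ℕ) : ℤ)) γ =
      c m * matrixCoeff k (fun w => w ^ m) (fun z => z ^ n) (γ * h) := by
  unfold monomialFourierCoeff
  have e : ∀ w : Circle,
      (starRingEnd ℂ) ((w : ℂ) ^ (-((k + 2 * m : ℕ) : ℤ))) *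
        matrixCoeff k (fun z => z ^ n) (fun z => z ^ n) (γ * (h * rot w * h⁻¹)) =
      (w : ℂ) ^ (k + 2 * m) * matrixCoeff k (act k h⁻¹ fun z => z ^ n) (fun z => z ^ n) (γ * h * rot w) := by
    intro w
    rw [matrixCoeff_monomial_conj_torus, conj_zpow_neg_natCast]
  simp_rw [e]
  exact integral_circle_pow_mul_matrixCoeff k hk c (act k h⁻¹ fun z => z ^ n)
    (differentiableOn_act k h⁻¹ _ (differentiableOn_monomial n)) hc
    (integrableOn_act k hk h⁻¹ _ (differentiableOn_monomial n) (integrableOn_monomial k n))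
    (fun j => if j = n then 1 else 0) (fun z => z ^ n) (fun w _ => hasSum_monomial n w) (integrableOn_monomial k n)
    m (γ * h)

omit [MeasurableSpace Circle] [BorelSpace Circle] in
/-- `⟨π_k(h) zᵐ, zⁿ⟩_k = conj(c_m) ⟨zᵐ, zᵐ⟩_k` -/
theorem matrixCoeff_monomial_monomial_eq (k : ℕ) (hk : 2 ≤ k) (n : ℕ) (h : SU11) (c : ℕ → ℂ)
    (hc : ∀ z ∈ ball (0 : ℂ) 1, HasSum (fun j => c j * z ^ j) (act k h⁻¹ (fun z => z ^ n) z)) (m : ℕ) :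
    matrixCoeff k (fun w => w ^ m) (fun z => z ^ n) h = (starRingEnd ℂ) (c m) * monomialNormSq k m := by
  unfold matrixCoeff
  rw [pairing_act_left k hk h, pairing_conj_symm, pairing_monomial_right k hk c _ hc
    (integrableOn_act k hk h⁻¹ _ (differentiableOn_monomial n) (integrableOn_monomial k n)) m]
  rw [map_mul, Complex.conj_ofReal]

/-- **`Φ_{−(k+2m)}(1) = |c_m|² ⟨zᵐ, zᵐ⟩_k`** -/
theorem monomialFourierCoeff_one (k : ℕ) (hk : 2 ≤ k) (n : ℕ) (h : SU11) (c : ℕ → ℂ)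
    (hc : ∀ z ∈ ball (0 : ℂ) 1, HasSum (fun j => c j * z ^ j) (act k h⁻¹ (fun z => z ^ n) z)) (m : ℕ) :
    monomialFourierCoeff k n h (-((k + 2 * m : ℕ) : ℤ)) 1 =
      (Complex.normSq (c m) : ℂ) * monomialNormSq k m := by
  rw [monomialFourierCoeff_eq k hk n h c hc m 1, one_mul, matrixCoeff_monomial_monomial_eq k hk n h c hc m,
    Complex.normSq_eq_conj_mul_self]
  ring

/-- **`hq` for `u_A = zⁿ` at the `K`-type `q = −(k+2m)` is `c_m ≠ 0`** -/
theorem monomialFourierCoeff_one_ne_zero_iff (k : ℕ) (hk : 2 ≤ k) (n : ℕ) (h : SU11) (c : ℕ → ℂ)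
    (hc : ∀ z ∈ ball (0 : ℂ) 1, HasSum (fun j => c j * z ^ j) (act k h⁻¹ (fun z => z ^ n) z)) (m : ℕ) :
    monomialFourierCoeff k n h (-((k + 2 * m : ℕ) : ℤ)) 1 ≠ 0 ↔ c m ≠ 0 := by
  rw [monomialFourierCoeff_one k hk n h c hc m]
  have hm : (monomialNormSq k m : ℂ) ≠ 0 := by exact_mod_cast (monomialNormSq_pos k m).ne'
  constructor
  · intro hne h0
    apply hne
    rw [h0, map_zero, Complex.ofReal_zero, zero_mul]
  · intro hne
    refine mul_ne_zero ?_ hm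
    exact_mod_cast (Complex.normSq_pos.2 hne).ne'

omit [BorelSpace Circle] in
/-- the inner integral over the second torus -/
theorem inner_integral_monomial (k n : ℕ) (hk : 2 ≤ k) (h : SU11) (u : Circle) (γ : SU11) (p q : ℤ) :
    ∫ w : Circle, matrixCoeff k (fun z => z ^ n) (fun z => z ^ n) (rot u * γ * (h * rot w * h⁻¹)) *
        ((u : ℂ) ^ p * (starRingEnd ℂ) ((w : ℂ) ^ q)) ∂haarCircle =
      (u : ℂ) ^ (p - ((k + 2 * n : ℕ) : ℤ)) * monomialFourierCoeff k n h q γ := by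
  have e : ∀ w : Circle,
      matrixCoeff k (fun z => z ^ n) (fun z => z ^ n) (rot u * γ * (h * rot w * h⁻¹)) *
          ((u : ℂ) ^ p * (starRingEnd ℂ) ((w : ℂ) ^ q)) =
      (u : ℂ) ^ (p - ((k + 2 * n : ℕ) : ℤ)) *
        ((starRingEnd ℂ) ((w : ℂ) ^ q) *
          matrixCoeff k (fun z => z ^ n) (fun z => z ^ n) (γ * (h * rot w * h⁻¹))) := by
    intro w
    rw [mul_assoc (rot u) γ, matrixCoeff_monomial_rot_mul k n hk,
      ← T7SupportBergmanTorusOrbital.inv_pow_mul_zpow u (k + 2 * n) p]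
    ring
  simp_rw [e]
  rw [integral_const_mul]
  rfl

/-- **the two-torus orbital integral of the one-vector coefficient of `zⁿ`**: `= [p = k + 2n] · Φ_q(γ)` -/
theorem torus_orbital_monomial_eq (k n : ℕ) (hk : 2 ≤ k) (h γ : SU11) (p q : ℤ) :
    ∫ u : Circle, ∫ w : Circle,
        matrixCoeff k (fun z => z ^ n) (fun z => z ^ n) (rot u * γ * (h * rot w * h⁻¹)) *
          ((u : ℂ) ^ p * (starRingEnd ℂ) ((w : ℂ) ^ q)) ∂haarCircle ∂haarCircle =
      (if p = ((k + 2 * n : ℕ) : ℤ) then 1 else 0) * monomialFourierCoeff k n h q γ := by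
  simp_rw [inner_integral_monomial k n hk h _ γ p q]
  have e : ∀ u : Circle, (u : ℂ) ^ (p - ((k + 2 * n : ℕ) : ℤ)) * monomialFourierCoeff k n h q γ =
      monomialFourierCoeff k n h q γ *
        ((u : ℂ) ^ (p - ((k + 2 * n : ℕ) : ℤ)) * (starRingEnd ℂ) ((u : ℂ) ^ (0 : ℤ))) := by
    intro u
    simp only [zpow_zero, map_one, mul_one]
    ring
  simp_rw [e]
  rw [integral_const_mul, integral_zpow_mul_conj_zpow]
  simp only [sub_eq_zero]
  ring

/-- **the orbital integral of the one-vector coefficient of `zⁿ` decays like `κ(γ)^{−k/2}`** -/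
theorem norm_torus_orbital_monomial_le_kappa (k n : ℕ) (hk : 2 ≤ k) (h γ : SU11) (p q : ℤ) :
    ‖∫ u : Circle, ∫ w : Circle,
        matrixCoeff k (fun z => z ^ n) (fun z => z ^ n) (rot u * γ * (h * rot w * h⁻¹)) *
          ((u : ℂ) ^ p * (starRingEnd ℂ) ((w : ℂ) ^ q)) ∂haarCircle ∂haarCircle‖ ≤
      shiftConst h ^ k * (decayConst k n n * monomialNormSq k n) *
        (kappa (starRingEnd ℂ) dd (colBasis h) (mat γ)).re ^ (-(k : ℝ) / 2) := by
  rw [torus_orbital_monomial_eq k n hk h γ p q, norm_mul]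
  have h1 : ‖(if p = ((k + 2 * n : ℕ) : ℤ) then (1 : ℂ) else 0)‖ ≤ 1 := by
    split_ifs <;> simp
  have hb : ∀ w : Circle,
      ‖(starRingEnd ℂ) ((w : ℂ) ^ q) *
        matrixCoeff k (fun z => z ^ n) (fun z => z ^ n) (γ * (h * rot w * h⁻¹))‖ ≤
      shiftConst h ^ k * (decayConst k n n * monomialNormSq k n) *
        (kappa (starRingEnd ℂ) dd (colBasis h) (mat γ)).re ^ (-(k : ℝ) / 2) := by
    intro w
    rw [norm_mul, Complex.norm_conj, norm_zpow, Circle.norm_coe, one_zpow, one_mul]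
    exact norm_matrixCoeff_monomial_conj_torus_le_kappa k hk n γ h w
  have h2 : ‖monomialFourierCoeff k n h q γ‖ ≤
      shiftConst h ^ k * (decayConst k n n * monomialNormSq k n) *
        (kappa (starRingEnd ℂ) dd (colBasis h) (mat γ)).re ^ (-(k : ℝ) / 2) := by
    unfold monomialFourierCoeff
    calc _ ≤ _ * (haarCircle : Measure Circle).real Set.univ :=
          norm_integral_le_of_norm_le_const (Filter.Eventually.of_forall hb)
      _ = _ := by rw [probReal_univ, mul_one]
  calc ‖(if p = ((k + 2 * n : ℕ) : ℤ) then (1 : ℂ) else 0)‖ * ‖monomialFourierCoeff k n h q γ‖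
      ≤ 1 * (shiftConst h ^ k * (decayConst k n n * monomialNormSq k n) *
          (kappa (starRingEnd ℂ) dd (colBasis h) (mat γ)).re ^ (-(k : ℝ) / 2)) := by
        gcongr
    _ = _ := one_mul _

end Summit.Ventures.HodgeRepro2.T7SupportBergmanOneVectorMonomial
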